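import Summits.ResolutionOfSingularities.ResolutionOfSingularities.Theorems.EquisingularLiftEquisingularLiftNatCechShadowPackage
import Summits.ResolutionOfSingularities.ResolutionOfSingularities.Theorems.EquisingularLiftEquisingularLiftNatTowerCechRoundCloserLiftThree
import Summits.ResolutionOfSingularities.ResolutionOfSingularities.Theorems.EquisingularLiftEquisingularLiftNatStrictTransformVanishingIdeal
import Summits.ResolutionOfSingularities.ResolutionOfSingularities.Theorems.EquisingularLiftEquisingularLiftNatStrictTransformExceptionalCartier
import Summits.ResolutionOfSingularities.ResolutionOfSingularities.Theorems.EquisingularLiftEquisingularLiftNatEffectiveCartierSwap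
import Summits.ResolutionOfSingularities.ResolutionOfSingularities.Theorems.EquisingularLiftEquisingularLiftNatCompleteIntersectionLiftCentre
import Literature.AlgebraicGeometry.Resolution.ExceptionalDivisorRegularGlobal
import Literature.AlgebraicGeometry.Resolution.BlowupsIntegral
import Literature.AlgebraicGeometry.Resolution.BlowupStalkEmbedding
import Literature.AlgebraicGeometry.Resolution.StrictTransformDistinct
import Literature.AlgebraicGeometry.Resolution.SpreadModelDataSpread
import Literature.AlgebraicGeometry.Resolution.KollarEtaleNeighbourhood
import HarnessLib

/-!
# [OURS · L1 W4.5(b) · EL♮(3)] (N3) DISCHARGED — `Tower.hShadow_of`: THE TRANSPORTED SHADOW NEXT TO THE NEW EXCEPTIONAL SURFACE AFTER A ČECH ROUND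
# OFF THE SHADOW (the `hShadow` binder of res-L1-w45b-stub-4's `Tower.hCech₃_of_lift_sec` p576661, LOCAL currency, VERBATIM as conclusion)

Crux chain w45b (cell `res-hironaka`, slot W4.5(b)), working crux **EL♮** = stmt-ResolutionOfSingularities-20038, child **EL♮(3)** =
stmt-ResolutionOfSingularities-20148, route EquisingularLift, line `sections`; registered stub `stub_elnat_coneTowerPointResolution` @ `ReachTower₄`
(v7 assembly `hsub_reachTower_four_of_kcl` p576510), stand-in S6 `hCech` = `Tower.hCech₃_of_lift_sec … hLift hShadow hShadowOld …`; THIS FILE supplies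
`hShadow` (sub-stand-in (N3)). Written by res-L1-w45b-stub-2 g8 (res-L1-w45b-lead-2 (γ) word 2026-08-27T21:14:43Z «(N3) TRUE as worded»;
res-L1-w45b-plan-1 RULING OF RECORD 22:17:09Z). HONEST FRAMING: OURS; NOT a statement of any manuscript; AI-written, weaker than expert review.
No `sorry`; standard axioms; DEF-FREE. `--supports stmt-ResolutionOfSingularities-20148 --as helper`.

WHAT. `Tower.hShadow_of O k θ hθ P q hqprop Y hYirr hYcl hPnoeth hPreg Ch hChain hPint` (`SmoothOfRelativeDimension 3 q` an instance argument) has as its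
TYPE the `hShadow` binder of `Tower.hCech₃_of_lift_sec` VERBATIM: for a Čech round `τ = Bl_𝒞`, `𝒞 = 𝓔 ⊔ 𝒦₁`, off the shadow
(`closure (Z ∖ closure K) = Z`), the five clauses (k-ii-loc)′, (k-iii)′, (k-iv)′, (k-v)′, (k-vi)′ of `Tower.Shadow₃` for the NEW pair
`(𝒞·𝒪_{X₂}, St_𝒞 𝒦)`. UNIFORM in `Z ∩ closure K` (no disjoint / points split).
HOW (res-L1-w45b-lead-2's route, regular sequences instead of primality): at each special point `y₂ = j₂ y` of the new exceptional surface the key local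
fact …NatCechShadowLocal (`St_𝒞 𝒦 = 𝒦·𝒪_{X₂}` at `y₂`; `(ϖ, w, f*)` regular in all orders; `n = 3` conditional regularity) fed by the package
…NatCechShadowPackage (off-the-shadow input …NatCechShadowTrace, flatness, T-DIM); (k-ii-loc)′ stalkwise on `υ₂⁻¹ V` by ANTISYMMETRY: `≤` is Literature
`comap_strictTransformIdeal_le` + `strictTransformIdeal_vanishingIdeal_eq` (the downstairs strict transform of `𝓘⟨K⟩` IS the reduced strict transform),
`≥` is trivial saturation in `𝒪_{G′,y}` (`w̄` regular modulo the transported shadow); (k-iii)′ by `CILift.flat_subschemeι_comp_of_forall_stalk`; (k-iv)′ by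
the local (d) with `dim 𝒪_{X,x}/𝒞_x ≤ 2` from T-DIM (`n = 3`); (k-v)′ = `isEffectiveCartier_comap_subschemeι_strictTransformIdeal` (saturation);
(k-vi)′ = `isEffectiveCartier_comap_subschemeι_swap`.

References (index only): [cite: GortzWedhorn2020, (13.19) and Prop. 13.91]; [cite: Liu2002, Thm. 8.1.19]; [cite: StacksProject, Tag 0BIQ]; [cite: Matsumura1987,
Thm. 14.2 and §16]. Tree inputs as named in the module docstrings of …NatCechShadow{ChartAlgebra,Ring,Trace,Local,Package}.
-/

set_option linter.dupNamespace false -- mandated namespace `Summit.<Summit>.<Problem>` of this single-conjunct summit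
set_option linter.overlappingInstances false -- signatures carry `[IsDomain O] [IsDiscreteValuationRing O]`

noncomputable section

open CategoryTheory CategoryTheory.Limits AlgebraicGeometry TopologicalSpace Topology IsLocalRing
open Literature.AlgebraicGeometry.Resolution
open Literature.AlgebraicGeometry.Morphisms (ProjCech.PP ProjCech.toSpec)
open AlgebraicGeometry.Scheme.IdealSheafData
open Summit.ResolutionOfSingularities.ResolutionOfSingularities.Theses.EquisingularLift.Split
open Summit.ResolutionOfSingularities.ResolutionOfSingularities.Cruxes.EquisingularLift.StrataSplit

namespace Summit.ResolutionOfSingularities.ResolutionOfSingularities.Cruxes.EquisingularLiftNat.Sections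

open CechShadow

set_option maxHeartbeats 1600000 in -- long binder text; five clauses with per-point packages
/-- **(N3) `hShadow` of `Tower.hCech₃_of_lift_sec`, DISCHARGED** (see the module docstring; the conclusion is the binder VERBATIM).
[cite: GortzWedhorn2020, (13.19) and Prop. 13.91] [cite: Liu2002, Thm. 8.1.19] [cite: StacksProject, Tag 0BIQ] [OURS · L1 W4.5b] S6 of TOWER₄ toward
`stub_elnat_coneTowerPointResolution` (stmt-ResolutionOfSingularities-20148 / -20038); NOT a statement of the manuscript. -/
theorem Tower.hShadow_of (O : Type) [CommRing O] [IsDomain O] [IsDiscreteValuationRing O] (k : Type) [Field k]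
    (θ : O →+* k) (hθ : Function.Surjective θ)
    (P : Scheme.{0}) (q : P ⟶ Spec (.of O)) (hqprop : IsProper q) (Y : Set P) (hYirr : IsIrreducible Y) (hYcl : IsClosed Y)
    (hPnoeth : IsLocallyNoetherian P) (hPreg : Scheme.IsRegular P)
    (Ch : ∀ X' : Scheme.{0}, (X' ⟶ P) → Set X' → Prop)
    (hChain : ∀ (X' : Scheme.{0}) (σ : X' ⟶ P) (S : Set X'), Ch X' σ S → Chain P Y X' σ S)
    (hPint : IsIntegral P) [SmoothOfRelativeDimension 3 q] :
    ∀ {F₉ : Scheme.{0}} (Z₉ : Set F₉) (hZ₉ : IsClosed Z₉) {F₁₀ : Scheme.{0}} (υ' : F₁₀ ⟶ F₉)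
        (G G' : Scheme.{0}) (γ : G ⟶ F₁₀) (T E K : Set G) (hE : IsClosed E) (Z : Set G) (hZ : IsClosed Z) (υ₂ : G' ⟶ G),
        DirStepSec F₉ F₁₀ υ' Z₉ hZ₉ G γ Z hZ → IsBlowup υ₂ (vanishingIdeal ⟨Z, hZ⟩) →
        ∀ (X : Scheme.{0}) (σ : X ⟶ P) (S : Set X) (jG : G ⟶ X) (tG : G ⟶ Spec (.of k)) (𝓔 𝒦 𝒦₁ : X.IdealSheafData)
        (X₂ : Scheme.{0}) (τ : X₂ ⟶ X) (j₂ : G' ⟶ X₂) (t₂ : G' ⟶ Spec (.of k)),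
        Ch X σ S → IsIntegral X → IsLocallyNoetherian X → Scheme.IsRegular X → IsDominant (σ ≫ q) →
        IsPullback jG tG (σ ≫ q) (Spec.map (CommRingCat.ofHom θ)) → jG '' T = S →
        𝓔.comap jG = vanishingIdeal ⟨E, hE⟩ → (∀ z : X, (stalkIdeal 𝓔 z).IsPrincipal) → Scheme.IsRegular 𝓔.subscheme →
        (∀ z : X, (stalkIdeal 𝒦 z).IsPrincipal) → ∀ (V : G.Opens), E ⊆ (V : Set G) →
        (𝒦.comap jG).comap V.ι = (vanishingIdeal (⟨closure K, isClosed_closure⟩ : Closeds G)).comap V.ι →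
        Flat ((𝓔 ⊔ 𝒦).subschemeι ≫ σ ≫ q) → IsEffectiveCartier (𝓔.comap 𝒦.subschemeι) → IsEffectiveCartier (𝒦.comap 𝓔.subschemeι) →
        (𝓔 ⊔ 𝒦₁).comap jG = vanishingIdeal ⟨Z, hZ⟩ → Flat ((𝓔 ⊔ 𝒦₁).subschemeι ≫ σ ≫ q) → Scheme.IsRegular (𝓔 ⊔ 𝒦₁).subscheme →
        IsEffectiveCartier (𝒦₁.comap 𝓔.subschemeι) →
        IsBlowup τ (𝓔 ⊔ 𝒦₁) → IsPullback j₂ t₂ ((τ ≫ σ) ≫ q) (Spec.map (CommRingCat.ofHom θ)) → j₂ ≫ τ = υ₂ ≫ jG →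
        IsClosed K → K ⊆ closure (K \ E) → K ≠ Set.univ → closure (Z \ closure K) = Z →
        ((strictTransformIdeal τ (𝓔 ⊔ 𝒦₁) 𝒦).comap j₂).comap (υ₂ ⁻¹ᵁ V).ι =
            (vanishingIdeal (⟨closure (closure (υ₂ ⁻¹' (K \ Z))), isClosed_closure⟩ : Closeds G')).comap (υ₂ ⁻¹ᵁ V).ι ∧
          Flat ((((𝓔 ⊔ 𝒦₁).comap τ) ⊔ strictTransformIdeal τ (𝓔 ⊔ 𝒦₁) 𝒦).subschemeι ≫ (τ ≫ σ) ≫ q) ∧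
          (∀ (hE' : IsClosed (υ₂ ⁻¹' Z)) (y : G'),
            j₂ y ∈ ((((𝓔 ⊔ 𝒦₁).comap τ) ⊔ strictTransformIdeal τ (𝓔 ⊔ 𝒦₁) 𝒦).support : Set X₂) →
            stalkIdeal (vanishingIdeal (⟨υ₂ ⁻¹' Z, hE'⟩ : Closeds G') ⊔
              vanishingIdeal (⟨closure (closure (υ₂ ⁻¹' (K \ Z))), isClosed_closure⟩ : Closeds G')) y =
            stalkIdeal (vanishingIdeal (⟨υ₂ ⁻¹' Z ∩ closure (closure (υ₂ ⁻¹' (K \ Z))), hE'.inter isClosed_closure⟩ : Closeds G')) y →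
            IsRegularLocalRing (X₂.presheaf.stalk (j₂ y) ⧸
              stalkIdeal (((𝓔 ⊔ 𝒦₁).comap τ) ⊔ strictTransformIdeal τ (𝓔 ⊔ 𝒦₁) 𝒦) (j₂ y))) ∧
          IsEffectiveCartier (((𝓔 ⊔ 𝒦₁).comap τ).comap (strictTransformIdeal τ (𝓔 ⊔ 𝒦₁) 𝒦).subschemeι) ∧
          IsEffectiveCartier ((strictTransformIdeal τ (𝓔 ⊔ 𝒦₁) 𝒦).comap ((𝓔 ⊔ 𝒦₁).comap τ).subschemeι) := by
  intro F₉ Z₉ hZ₉ F₁₀ υ' G G' γ T E K hE Z hZ υ₂ hsec hυ₂ X σ S jG tG 𝓔 𝒦 𝒦₁ X₂ τ j₂ t₂ hCh hXint hXnoeth hXreg hdom hsq hTS he_i he_ii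
    he_iii hk_i V hEV hk_ii hk_iii hk_v hk_vi hc1 hc2 hc3 hc4 hτ hsq₂ hcomm hKcl hKE hKne hoff
  classical
  haveI := hqprop
  haveI := hXint
  haveI := hXnoeth
  haveI := hPint
  obtain ⟨-, -, hσ⟩ := chain_isRegular P Y X σ S (hChain _ _ _ hCh) hPnoeth hPreg
  haveI := hσ
  haveI : IsProper (σ ≫ q) := inferInstance
  haveI : IsClosedImmersion (Spec.map (CommRingCat.ofHom θ)) := IsClosedImmersion.spec_of_surjective _ hθ
  haveI hjci : IsClosedImmersion jG := MorphismProperty.IsStableUnderBaseChange.of_isPullback hsq.flip inferInstance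
  have hsq₂' : IsPullback j₂ t₂ (τ ≫ σ ≫ q) (Spec.map (CommRingCat.ofHom θ)) := by simpa only [Category.assoc] using hsq₂
  haveI hj₂ci : IsClosedImmersion j₂ := MorphismProperty.IsStableUnderBaseChange.of_isPullback hsq₂'.flip inferInstance
  haveI : IsProper τ := hτ.isProper
  haveI hX₂noeth : IsLocallyNoetherian X₂ := LocallyOfFiniteType.isLocallyNoetherian τ
  haveI : IsLocallyNoetherian G := LocallyOfFiniteType.isLocallyNoetherian jG
  haveI : IsLocallyNoetherian G' := LocallyOfFiniteType.isLocallyNoetherian j₂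
  -- `G` is proper over `Spec k`, hence a Noetherian space
  haveI : IsProper tG := MorphismProperty.IsStableUnderBaseChange.of_isPullback hsq inferInstance
  haveI : CompactSpace G := QuasiCompact.compactSpace_of_compactSpace tG
  haveI : IsNoetherian G := ⟨⟩
  obtain ⟨ϖ, hϖ⟩ := IsDiscreteValuationRing.exists_irreducible O
  have hKc : closure K = K := hKcl.closure_eq
  -- the centre is non-zero; the blow-up is integral; exceptional data
  have hCne : 𝓔 ⊔ 𝒦₁ ≠ ⊥ := by
    intro hbot
    have hE0 : 𝓔 = ⊥ := le_bot_iff.mp (hbot ▸ le_sup_left)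
    have hK₁0 : 𝒦₁ = ⊥ := le_bot_iff.mp (hbot ▸ le_sup_right)
    obtain ⟨x₀⟩ := (inferInstance : Nonempty X)
    have hx₀ : x₀ ∈ (𝓔.support : Set X) := by rw [hE0, Scheme.IdealSheafData.support_bot]; trivial
    obtain ⟨xe, -⟩ : x₀ ∈ Set.range 𝓔.subschemeι := by rw [Scheme.IdealSheafData.range_subschemeι]; exact hx₀
    obtain ⟨t, ht, hKt⟩ := hc4.exists_stalkIdeal_eq_span xe
    rw [hK₁0, Scheme.IdealSheafData.comap_bot, stalkIdeal_bot, eq_comm, Ideal.span_singleton_eq_bot] at hKt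
    rw [hKt] at ht
    exact zero_notMem_nonZeroDivisors ht
  haveI hX₂int : IsIntegral X₂ := hτ.isIntegral hCne
  have he2 : ∀ z : X₂, (stalkIdeal ((𝓔 ⊔ 𝒦₁).comap τ) z).IsPrincipal := fun z => by
    obtain ⟨u, -, hu⟩ := hτ.isEffectiveCartier.exists_stalkIdeal_eq_span z
    exact ⟨⟨u, by rw [hu, Ideal.submodule_span_eq]⟩⟩
  have he3 : Scheme.IsRegular ((𝓔 ⊔ 𝒦₁).comap τ).subscheme := hτ.isRegular_subscheme_comap hXreg hc3
  have hk1 : ∀ z : X₂, (stalkIdeal (strictTransformIdeal τ (𝓔 ⊔ 𝒦₁) 𝒦) z).IsPrincipal := fun z =>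
    isPrincipal_stalkIdeal_strictTransformIdeal hXreg hc3 hτ hCne 𝒦 hk_i z
  -- support bookkeeping: `Z ⊆ E ⊆ V`
  have hsuppZ : ((((𝓔 ⊔ 𝒦₁).comap jG)).support : Set G) = Z := by rw [hc1, Scheme.IdealSheafData.coe_support_vanishingIdeal]; rfl
  have hsuppE : ((𝓔.comap jG).support : Set G) = E := by rw [he_i, Scheme.IdealSheafData.coe_support_vanishingIdeal]; rfl
  have hZE : Z ⊆ E := by
    rw [← hsuppZ, ← hsuppE]
    exact Scheme.IdealSheafData.support_antitone (Scheme.IdealSheafData.comap_mono jG (le_sup_left : 𝓔 ≤ 𝓔 ⊔ 𝒦₁))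
  have hZV : ∀ p ∈ Z, p ∈ (V : Set G) := fun p hp => hEV (hZE hp)
  have hoff' : Z ⊆ closure (Z \ closure K) := by rw [hoff]
  have hKZ : ∀ p ∈ Z, stalkIdeal (𝒦.comap jG) p = stalkIdeal (vanishingIdeal (⟨closure K, isClosed_closure⟩ : Closeds G)) p :=
    fun p hp => stalkIdeal_eq_of_comap_ι_eq hk_ii (hZV p hp)
  -- the points of the new special fibre over the centre trace
  have hpt : ∀ y : G', τ (j₂ y) = jG (υ₂ y) := fun y => by
    rw [← Scheme.Hom.comp_apply, hcomm, Scheme.Hom.comp_apply]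
  have hZiff : ∀ y : G', υ₂ y ∈ Z ↔ τ (j₂ y) ∈ ((𝓔 ⊔ 𝒦₁).support : Set X) := fun y => by
    rw [hpt, ← hsuppZ, Scheme.IdealSheafData.support_comap]; rfl
  have hZiff' : ∀ y : G', υ₂ y ∈ Z ↔ j₂ y ∈ ((((𝓔 ⊔ 𝒦₁).comap τ)).support : Set X₂) := fun y => by
    rw [hZiff, Scheme.IdealSheafData.support_comap]; rfl
  have hspec : ∀ y : G', ((τ ≫ σ) ≫ q) (j₂ y) = closedPoint O := fun y => by
    have h1 : j₂ y ∈ Set.range j₂ := ⟨y, rfl⟩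
    rw [range_eq_preimage_of_isPullback hsq₂, range_specMap_of_surjective_of_field θ hθ] at h1
    exact h1
  -- germs of the uniformiser along `τ`
  have hgermτ : ∀ x' : X₂, (τ.stalkMap x').hom ((X.presheaf.Γgerm (τ x')).hom ((σ ≫ q).appTop.hom ((Scheme.ΓSpecIso (.of O)).inv.hom ϖ))) =
      (X₂.presheaf.Γgerm x').hom (((τ ≫ σ) ≫ q).appTop.hom ((Scheme.ΓSpecIso (.of O)).inv.hom ϖ)) := by
    intro x'
    rw [Category.assoc, Scheme.Hom.comp_appTop τ (σ ≫ q)]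
    exact Scheme.Hom.germ_stalkMap_apply τ ⊤ x' trivial _
  -- kernel of `j₂^♯` at `y`
  have hker₂ : ∀ y : G', RingHom.ker (j₂.stalkMap y).hom ≤
      Ideal.span {(τ.stalkMap (j₂ y)).hom ((X.presheaf.Γgerm (τ (j₂ y))).hom ((σ ≫ q).appTop.hom ((Scheme.ΓSpecIso (.of O)).inv.hom ϖ)))} :=
    fun y => by rw [hgermτ]; exact ker_stalkMap_model_le O k θ hθ ((τ ≫ σ) ≫ q) j₂ t₂ hsq₂ y ϖ hϖ
  have hϖ₂0 : ∀ y : G', (j₂.stalkMap y).hom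
      ((τ.stalkMap (j₂ y)).hom ((X.presheaf.Γgerm (τ (j₂ y))).hom ((σ ≫ q).appTop.hom ((Scheme.ΓSpecIso (.of O)).inv.hom ϖ)))) = 0 :=
    fun y => by rw [hgermτ]; exact stalkMap_model_varpi θ hθ ((τ ≫ σ) ≫ q) j₂ t₂ hsq₂ y ϖ (hϖ.maximalIdeal_eq ▸ Ideal.mem_span_singleton_self ϖ)
  -- the package at the points over `Z`, at the literal point `τ (j₂ y)`
  have hpkg : ∀ y : G', υ₂ y ∈ Z → ∃ f : X.presheaf.stalk (τ (j₂ y)), stalkIdeal 𝒦 (τ (j₂ y)) = Ideal.span {f} ∧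
      (∀ a, f * a ∈ stalkIdeal (𝓔 ⊔ 𝒦₁) (τ (j₂ y)) ⊔
          Ideal.span {(X.presheaf.Γgerm (τ (j₂ y))).hom ((σ ≫ q).appTop.hom ((Scheme.ΓSpecIso (.of O)).inv.hom ϖ))} →
        a ∈ stalkIdeal (𝓔 ⊔ 𝒦₁) (τ (j₂ y)) ⊔
          Ideal.span {(X.presheaf.Γgerm (τ (j₂ y))).hom ((σ ≫ q).appTop.hom ((Scheme.ΓSpecIso (.of O)).inv.hom ϖ))}) ∧
      (∀ a, (X.presheaf.Γgerm (τ (j₂ y))).hom ((σ ≫ q).appTop.hom ((Scheme.ΓSpecIso (.of O)).inv.hom ϖ)) * a ∈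
          stalkIdeal (𝓔 ⊔ 𝒦₁) (τ (j₂ y)) → a ∈ stalkIdeal (𝓔 ⊔ 𝒦₁) (τ (j₂ y))) ∧
      stalkIdeal (𝓔 ⊔ 𝒦₁) (τ (j₂ y)) ⊔
          Ideal.span {(X.presheaf.Γgerm (τ (j₂ y))).hom ((σ ≫ q).appTop.hom ((Scheme.ΓSpecIso (.of O)).inv.hom ϖ))} ≠ ⊤ := by
    intro y hp
    have h := exists_cechShadow_package O k θ hθ (σ ≫ q) jG tG hsq ϖ hϖ (𝓔 ⊔ 𝒦₁) 𝒦 hc2 Z (closure K) hZ isClosed_closure hc1 hk_i hKZ hoff'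
      (υ₂ y) hp
    rw [← hpt y] at h
    exact h
  -- downstairs: the strict transform of the reduced shadow IS the reduced strict transform
  have hStK : strictTransformIdeal υ₂ (vanishingIdeal (⟨Z, hZ⟩ : Closeds G)) (vanishingIdeal (⟨closure K, isClosed_closure⟩ : Closeds G)) =
      vanishingIdeal (⟨closure (closure (υ₂ ⁻¹' (K \ Z))), isClosed_closure⟩ : Closeds G') := by
    rw [strictTransformIdeal_vanishingIdeal_eq υ₂ _ hυ₂ (closure K) isClosed_closure]
    congr 1
    apply Closeds.ext
    change closure (υ₂ ⁻¹' (closure K \ ((vanishingIdeal (⟨Z, hZ⟩ : Closeds G)).support : Set G))) = closure (closure (υ₂ ⁻¹' (K \ Z)))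
    rw [closure_closure, Scheme.IdealSheafData.coe_support_vanishingIdeal, hKc]
    rfl
  -- the total transforms of the shadow and of the centre through the model square
  have hsqK : (𝒦.comap τ).comap j₂ = (𝒦.comap jG).comap υ₂ := by
    rw [← Scheme.IdealSheafData.comap_comp, hcomm, Scheme.IdealSheafData.comap_comp]
  have hsqC : ((𝓔 ⊔ 𝒦₁).comap τ).comap j₂ = (vanishingIdeal (⟨Z, hZ⟩ : Closeds G)).comap υ₂ := by
    rw [← Scheme.IdealSheafData.comap_comp, hcomm, Scheme.IdealSheafData.comap_comp, hc1]
  -- (k-ii-loc)′ STALKWISE on `υ₂⁻¹ V`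
  have hstalk : ∀ y : G', υ₂ y ∈ (V : Set G) →
      stalkIdeal ((strictTransformIdeal τ (𝓔 ⊔ 𝒦₁) 𝒦).comap j₂) y =
        stalkIdeal (vanishingIdeal (⟨closure (closure (υ₂ ⁻¹' (K \ Z))), isClosed_closure⟩ : Closeds G')) y := by
    intro y hyV
    rw [← hStK]
    have hKp : stalkIdeal (𝒦.comap jG) (υ₂ y) = stalkIdeal (vanishingIdeal (⟨closure K, isClosed_closure⟩ : Closeds G)) (υ₂ y) :=
      stalkIdeal_eq_of_comap_ι_eq hk_ii hyV
    -- the common value `A_y = (𝒦·𝒪_{X₂})·𝒪_{G′,y} = (𝓘⟨K⟩·𝒪_{G′})_y`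
    have hA : stalkIdeal ((𝒦.comap τ).comap j₂) y =
        (stalkIdeal (vanishingIdeal (⟨closure K, isClosed_closure⟩ : Closeds G)) (υ₂ y)).map (υ₂.stalkMap y).hom := by
      rw [hsqK, stalkIdeal_comap_eq_map_stalkMap, hKp]
    by_cases hpZ : υ₂ y ∈ Z
    · obtain ⟨f, hf, hG1, hϖreg, hne⟩ := hpkg y hpZ
      obtain ⟨w, hEw, hSt, hb, -, -⟩ := exists_generator_cechShadow_local hXreg hc3 hτ 𝒦 (j₂ y) ((hZiff y).mp hpZ) f _ hf hG1 hϖreg hne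
      have hAy : stalkIdeal ((𝒦.comap τ).comap j₂) y = (Ideal.span {(τ.stalkMap (j₂ y)).hom f}).map (j₂.stalkMap y).hom := by
        rw [stalkIdeal_comap_eq_map_stalkMap, stalkIdeal_comap_eq_map_stalkMap, hf, Ideal.map_span, Set.image_singleton]
      have hL : stalkIdeal ((strictTransformIdeal τ (𝓔 ⊔ 𝒦₁) 𝒦).comap j₂) y = stalkIdeal ((𝒦.comap τ).comap j₂) y := by
        rw [stalkIdeal_comap_eq_map_stalkMap, hSt, hAy]
      have hEy : stalkIdeal ((vanishingIdeal (⟨Z, hZ⟩ : Closeds G)).comap υ₂) y = Ideal.span {(j₂.stalkMap y).hom w} := by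
        rw [← hsqC, stalkIdeal_comap_eq_map_stalkMap, hEw, Ideal.map_span, Set.image_singleton]
      rw [hL, stalkIdeal_strictTransformIdeal, ← hA, hEy]
      refine (iSup_colon_pow_eq_of_forall_mul_mem _ _ _ rfl ?_).symm
      -- `w̄` is a nonzerodivisor modulo the transported shadow (clause (b) of the local fact, through `j₂^♯`)
      intro z hz
      obtain ⟨z, rfl⟩ := j₂.stalkMap_surjective y z
      rw [hAy] at hz ⊢
      rw [← map_mul] at hz
      have h1 : w * z ∈ Ideal.span {(τ.stalkMap (j₂ y)).hom f} ⊔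
          Ideal.span {(τ.stalkMap (j₂ y)).hom ((X.presheaf.Γgerm (τ (j₂ y))).hom ((σ ≫ q).appTop.hom ((Scheme.ΓSpecIso (.of O)).inv.hom ϖ)))} := by
        have h2 : w * z ∈ Ideal.comap (j₂.stalkMap y).hom ((Ideal.span {(τ.stalkMap (j₂ y)).hom f}).map (j₂.stalkMap y).hom) := hz
        rw [Ideal.comap_map_of_surjective _ (j₂.stalkMap_surjective y), ← RingHom.ker_eq_comap_bot] at h2
        exact (sup_le_sup_left (hker₂ y) _) h2
      have h3 := hb z h1
      have h4 : (j₂.stalkMap y).hom z ∈ (Ideal.span {(τ.stalkMap (j₂ y)).hom f} ⊔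
          Ideal.span {(τ.stalkMap (j₂ y)).hom ((X.presheaf.Γgerm (τ (j₂ y))).hom ((σ ≫ q).appTop.hom ((Scheme.ΓSpecIso (.of O)).inv.hom ϖ)))}).map
            (j₂.stalkMap y).hom := Ideal.mem_map_of_mem _ h3
      rw [Ideal.map_sup, Ideal.map_span _ {(τ.stalkMap (j₂ y)).hom ((X.presheaf.Γgerm (τ (j₂ y))).hom _)}, Set.image_singleton, hϖ₂0 y,
        Ideal.span_singleton_eq_bot.mpr rfl, sup_bot_eq] at h4
      exact h4
    · -- off the new exceptional surface both sides are total transforms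
      have hy₂ : j₂ y ∉ ((((𝓔 ⊔ 𝒦₁).comap τ)).support : Set X₂) := fun h => hpZ ((hZiff' y).mpr h)
      have hy' : y ∉ ((((vanishingIdeal (⟨Z, hZ⟩ : Closeds G)).comap υ₂)).support : Set G') := by
        rw [Scheme.IdealSheafData.support_comap]
        intro h
        apply hpZ
        have h' : υ₂ y ∈ ((vanishingIdeal (⟨Z, hZ⟩ : Closeds G)).support : Set G) := h
        rwa [Scheme.IdealSheafData.coe_support_vanishingIdeal] at h'
      rw [stalkIdeal_strictTransformIdeal_of_not_mem υ₂ _ _ hy', ← hA, stalkIdeal_comap_eq_map_stalkMap,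
        stalkIdeal_strictTransformIdeal_of_not_mem τ _ _ hy₂, stalkIdeal_comap_eq_map_stalkMap, stalkIdeal_comap_eq_map_stalkMap]
  refine ⟨comap_ι_eq_of_forall_stalkIdeal_eq (υ₂ ⁻¹ᵁ V) fun y hy => hstalk y hy, ?_, ?_,
    isEffectiveCartier_comap_subschemeι_strictTransformIdeal τ (𝓔 ⊔ 𝒦₁) 𝒦 hτ.isEffectiveCartier, ?_⟩
  · -- (k-iii)′ flatness of the new pair, on the special stalks (clause (c) of the local fact)
    refine CILift.flat_subschemeι_comp_of_forall_stalk O ((τ ≫ σ) ≫ q) _ ϖ hϖ fun x' hx' hx's a ha => ?_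
    obtain ⟨y, rfl⟩ : x' ∈ Set.range j₂ := by
      rw [range_eq_preimage_of_isPullback hsq₂, range_specMap_of_surjective_of_field θ hθ]; exact hx's
    have hpZ : υ₂ y ∈ Z := (hZiff' y).mpr (Scheme.IdealSheafData.support_antitone le_sup_left hx')
    obtain ⟨f, hf, hG1, hϖreg, hne⟩ := hpkg y hpZ
    obtain ⟨w, hEw, hSt, -, hc, -⟩ := exists_generator_cechShadow_local hXreg hc3 hτ 𝒦 (j₂ y) ((hZiff y).mp hpZ) f _ hf hG1 hϖreg hne
    rw [stalkIdeal_sup, hEw, hSt] at ha ⊢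
    rw [← hgermτ] at ha
    exact hc a ha
  · -- (k-iv)′ conditional regularity on the fibre lines, `n = 3` (clause (d) of the local fact)
    intro hE' y hy hrad
    have hyE : j₂ y ∈ ((((𝓔 ⊔ 𝒦₁).comap τ)).support : Set X₂) := Scheme.IdealSheafData.support_antitone le_sup_left hy
    have hpZ : υ₂ y ∈ Z := (hZiff' y).mpr hyE
    obtain ⟨f, hf, hG1, hϖreg, hne⟩ := hpkg y hpZ
    obtain ⟨w, hEw, hSt, -, -, hd⟩ := exists_generator_cechShadow_local hXreg hc3 hτ 𝒦 (j₂ y) ((hZiff y).mp hpZ) f _ hf hG1 hϖreg hne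
    have hsum : stalkIdeal (((𝓔 ⊔ 𝒦₁).comap τ) ⊔ strictTransformIdeal τ (𝓔 ⊔ 𝒦₁) 𝒦) (j₂ y) =
        Ideal.span {w} ⊔ Ideal.span {(τ.stalkMap (j₂ y)).hom f} := by rw [stalkIdeal_sup, hEw, hSt]
    rw [hsum]
    -- `f ∈ 𝔪` (the point lies on the transported shadow)
    have hfm : f ∈ maximalIdeal (X.presheaf.stalk (τ (j₂ y))) := by
      rw [mem_maximalIdeal, mem_nonunits_iff]
      intro hu
      have hySt : j₂ y ∈ ((strictTransformIdeal τ (𝓔 ⊔ 𝒦₁) 𝒦).support : Set X₂) := Scheme.IdealSheafData.support_antitone le_sup_right hy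
      have h1 := (mem_support_iff_stalkIdeal_le _ _).mp hySt
      rw [hSt, Ideal.span_singleton_le_iff_mem] at h1
      exact (mem_maximalIdeal _).mp h1 (hu.map _)
    -- `𝓔 ≠ ⊥` (the shadow is non-empty at `p`, so `E ≠ G`)
    have h𝓔ne : 𝓔 ≠ ⊥ := by
      intro hE0
      have hpK : υ₂ y ∈ closure K := by
        have h1 : τ (j₂ y) ∈ 𝒦.support :=
          (mem_support_iff_stalkIdeal_le _ _).mpr (by rw [hf, Ideal.span_singleton_le_iff_mem]; exact hfm)
        rw [hpt] at h1
        have h2 : υ₂ y ∈ (𝒦.comap jG).support := by rw [Scheme.IdealSheafData.support_comap]; exact h1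
        have h3 := (mem_support_iff_stalkIdeal_le _ _).mp h2
        rw [hKZ _ hpZ] at h3
        have h4 : υ₂ y ∈ ((vanishingIdeal (⟨closure K, isClosed_closure⟩ : Closeds G)).support : Set G) :=
          (mem_support_iff_stalkIdeal_le _ _).mpr h3
        rwa [Scheme.IdealSheafData.coe_support_vanishingIdeal] at h4
      rw [hKc] at hpK
      have hEuniv : E = Set.univ := by
        rw [← hsuppE, hE0, Scheme.IdealSheafData.comap_bot, Scheme.IdealSheafData.support_bot]; rfl
      have h4 := hKE hpK
      rw [hEuniv, Set.sdiff_eq_empty.mpr (Set.subset_univ K), closure_empty] at h4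
      exact h4
    refine hd ?_ hfm ?_
    · -- `dim 𝒪_{X,x}/𝒞_x ≤ 2` (T-DIM: `dim 𝒪_{X,x} ≤ 4` on the special fibre, minus the two Cartier equations of the centre)
      have hxs : (σ ≫ q) (τ (j₂ y)) = closedPoint O := by
        have h := hspec y; rwa [Scheme.Hom.comp_apply] at h
      have hdimA := ringKrullDim_stalk_le_of_chain q 3 hYirr hYcl hPnoeth hPreg (hChain _ _ _ hCh) (τ (j₂ y)) hxs
      exact ringKrullDim_quotient_centre_le hXreg 𝓔 𝒦₁ h𝓔ne he_ii hc4 (τ (j₂ y)) ((hZiff y).mp hpZ) hdimA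
    · -- reducedness of `R/(w, ϖ₂, f*)` from the radical trace hypothesis through `j₂^♯`
      have he1 : (((𝓔 ⊔ 𝒦₁).comap τ)).comap j₂ = vanishingIdeal (⟨υ₂ ⁻¹' Z, hE'⟩ : Closeds G') :=
        comap_comap_eq_vanishingIdeal_preimage_of_regular O k θ hθ (σ ≫ q) jG tG hsq (𝓔 ⊔ 𝒦₁) hXreg hc3 τ hτ j₂ t₂ hsq₂' υ₂ hcomm Z hZ hc1
      set ψ := (j₂.stalkMap y).hom with hψ
      set J : Ideal (X₂.presheaf.stalk (j₂ y)) := Ideal.span {w} ⊔ Ideal.span {(τ.stalkMap (j₂ y)).hom f} with hJ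
      have hJmap : J.map ψ = stalkIdeal (vanishingIdeal (⟨υ₂ ⁻¹' Z ∩ closure (closure (υ₂ ⁻¹' (K \ Z))), hE'.inter isClosed_closure⟩ :
          Closeds G')) y := by
        rw [← hrad, stalkIdeal_sup, ← he1, ← hstalk y (hZV _ hpZ), stalkIdeal_comap_eq_map_stalkMap, hEw, stalkIdeal_comap_eq_map_stalkMap,
          hSt, ← Ideal.map_sup]
      haveI := ComponentGluing.isReduced_subscheme_vanishingIdeal
        (⟨υ₂ ⁻¹' Z ∩ closure (closure (υ₂ ⁻¹' (K \ Z))), hE'.inter isClosed_closure⟩ : Closeds G')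
      have hJrad : (J.map ψ).IsRadical := by
        rw [hJmap]; exact isRadical_stalkIdeal_of_isReduced_subscheme _ y
      -- `R / (J + ker ψ) ≅ 𝒪_{G′,y} / ψ(J)` is reduced, and `J + ker ψ = (w) + ((ϖ₂) + (f*))`
      set φ : (X₂.presheaf.stalk (j₂ y) : Type) →+* (G'.presheaf.stalk y ⧸ J.map ψ) := (Ideal.Quotient.mk (J.map ψ)).comp ψ with hφ
      have hφsurj : Function.Surjective φ := Ideal.Quotient.mk_surjective.comp (j₂.stalkMap_surjective y)
      have hkerφ : RingHom.ker φ = Ideal.span {w} ⊔ (Ideal.span {(τ.stalkMap (j₂ y)).hom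
          ((X.presheaf.Γgerm (τ (j₂ y))).hom ((σ ≫ q).appTop.hom ((Scheme.ΓSpecIso (.of O)).inv.hom ϖ)))} ⊔
            Ideal.span {(τ.stalkMap (j₂ y)).hom f}) := by
        have h1 : RingHom.ker φ = Ideal.comap ψ (J.map ψ) := by
          rw [hφ, ← RingHom.comap_ker, Ideal.mk_ker]
        have hkerψ : RingHom.ker ψ = Ideal.span {(τ.stalkMap (j₂ y)).hom
            ((X.presheaf.Γgerm (τ (j₂ y))).hom ((σ ≫ q).appTop.hom ((Scheme.ΓSpecIso (.of O)).inv.hom ϖ)))} := by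
          refine le_antisymm (hker₂ y) ?_
          rw [Ideal.span_singleton_le_iff_mem, RingHom.mem_ker]
          exact hϖ₂0 y
        rw [h1, Ideal.comap_map_of_surjective _ (j₂.stalkMap_surjective y), ← RingHom.ker_eq_comap_bot, hkerψ, hJ]
        rw [sup_assoc, sup_comm (Ideal.span {(τ.stalkMap (j₂ y)).hom f})]
      haveI : IsReduced (G'.presheaf.stalk y ⧸ J.map ψ) := (Ideal.isRadical_iff_quotient_reduced _).mp hJrad
      have e := RingHom.quotientKerEquivOfSurjective hφsurj
      haveI : IsReduced (X₂.presheaf.stalk (j₂ y) ⧸ RingHom.ker φ) := isReduced_of_injective e.toRingHom e.injective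
      exact isReduced_of_injective (Ideal.quotEquivOfEq hkerφ.symm).toRingHom (Ideal.quotEquivOfEq hkerφ.symm).injective
  · -- (k-vi)′ by the swap (the new exceptional surface is regular, both ideals are locally principal)
    by_cases hK0 : 𝒦 = ⊥
    · -- degenerate: `𝒦 = ⊥` forces `V(𝓔) = ∅` (by (k-vi)), hence the new exceptional surface is empty
      have hEtop : 𝓔 = ⊤ := by
        rw [← Scheme.IdealSheafData.support_eq_bot_iff, eq_bot_iff]
        intro x hx
        obtain ⟨xe, -⟩ : x ∈ Set.range 𝓔.subschemeι := by rw [Scheme.IdealSheafData.range_subschemeι]; exact hx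
        obtain ⟨t, ht, hKt⟩ := hk_vi.exists_stalkIdeal_eq_span xe
        rw [hK0, Scheme.IdealSheafData.comap_bot, stalkIdeal_bot, eq_comm, Ideal.span_singleton_eq_bot] at hKt
        rw [hKt] at ht
        exact absurd ht (zero_notMem_nonZeroDivisors)
      have hE₂top : (𝓔 ⊔ 𝒦₁).comap τ = ⊤ := by rw [hEtop, top_sup_eq, Scheme.IdealSheafData.comap_top]
      rw [hE₂top]
      intro z
      exfalso
      have hz : ((⊤ : X₂.IdealSheafData)).subschemeι z ∈ ((⊤ : X₂.IdealSheafData).support : Set X₂) := by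
        rw [← Scheme.IdealSheafData.range_subschemeι]; exact ⟨z, rfl⟩
      rw [Scheme.IdealSheafData.support_top] at hz
      exact hz
    · have hStne : strictTransformIdeal τ (𝓔 ⊔ 𝒦₁) 𝒦 ≠ ⊥ := by
        intro h0
        obtain ⟨z₀⟩ := (inferInstance : Nonempty X₂)
        have hle : 𝒦.comap τ ≤ strictTransformIdeal τ (𝓔 ⊔ 𝒦₁) 𝒦 := comap_le_strictTransformIdeal τ (𝓔 ⊔ 𝒦₁) 𝒦
        rw [h0, le_bot_iff] at hle
        apply stalkIdeal_ne_bot_of_ne_bot hK0 (τ z₀)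
        have h3 : stalkIdeal (𝒦.comap τ) z₀ = ⊥ := by rw [hle, stalkIdeal_bot]
        rw [stalkIdeal_comap_eq_map_stalkMap] at h3
        exact (Ideal.map_eq_bot_iff_of_injective (hτ.stalkMap_injective z₀)).mp h3
      exact isEffectiveCartier_comap_subschemeι_swap ((𝓔 ⊔ 𝒦₁).comap τ) (strictTransformIdeal τ (𝓔 ⊔ 𝒦₁) 𝒦) he2 hk1 he3 hStne
        (isEffectiveCartier_comap_subschemeι_strictTransformIdeal τ (𝓔 ⊔ 𝒦₁) 𝒦 hτ.isEffectiveCartier)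

end Summit.ResolutionOfSingularities.ResolutionOfSingularities.Cruxes.EquisingularLiftNat.Sections

end
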